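import Summits.BirchSwinnertonDyer.BirchSwinnertonDyer.Theorems.CumulativeHeegnerLeopoldtEisensteinCharacterInvariantsAtThreeCellTorsion
import Summits.BirchSwinnertonDyer.BirchSwinnertonDyer.Theorems.CumulativeHeegnerLeopoldtEisensteinCharacterInvariantsAtThreeAlgebraicHalfOfResidualFinite
import Summits.BirchSwinnertonDyer.BirchSwinnertonDyer.Theorems.CumulativeHeegnerLeopoldtCumulativeHeegnerInclusionAtThreeB1OfPrint
import Summits.BirchSwinnertonDyer.BirchSwinnertonDyer.Theorems.CumulativeHeegnerLeopoldtCumulativeHeegnerInclusionAtThreeLineDeterminantAtThree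
import Summits.BirchSwinnertonDyer.BirchSwinnertonDyer.Theorems.CumulativeHeegnerLeopoldtCumulativeHeegnerInclusionAtThreeBadPlacesSplitFinite
import Summits.BirchSwinnertonDyer.BirchSwinnertonDyer.Theorems.EisensteinPrimesGoodLatticeOmegaPrelims
import Summits.BirchSwinnertonDyer.Rank1Residual.Partition.AnticyclotomicControlJSWEmbAt
import Summits.BirchSwinnertonDyer.Rank1Residual.X11b.Three.StepLAtThree
import HarnessLib

/-!
# Route `CumulativeHeegnerLeopoldt`, crux K2 `EisensteinCharacterInvariantsAtThree` (stmt-BirchSwinnertonDyer-24199):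
# the character cut SHARPENED to the full comparison `λ_alg = λ_an` (no K1) and composed to K2 at odd `d_K`

Lead prover `bsd-line-chl-p1` g9 (`--supports 24199`). The g8 helper `…OfCharacterCut` (p614352) proved
K2′_odd («`∃ n ≤ λ(X_{∅,0}(𝔭′))`, `‖L_n‖ = 1`») from [TOR] [LOC₃] [ALG] [AN] [BRram] + the K5 shapes
`CharMainConjOnTree 3` ([BR𝟙]) and `KatzLFunctionExistsFor 3` ([F1b]); the INEQUALITY came from the slack
`λ(𝔛_{θunr}) = λ(L_φ) + [θunr|_{G_K} = 𝟙]` of [BR𝟙], and turning K2′ into K2 needed the other crux K1 (p610835).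
THIS FILE removes both defects:

* §1 `exists_teichmullerPair_of_line` — the Teichmüller pair `(θsub, θquot)` of `G_ℚ` exists on ANY given rational
  `p`-line `Φ` (the K5 construction `EisensteinPrimesMuLambda.exists_teichmullerPair`, which chose its own line, re-run
  on a prescribed one), so that the pair can be taken on THE cell's non-anomalous line;
* §2 `restrictField_ne_one_of_isTeichmullerLiftOnQuot_of_cell` — on the Leopoldt cell the QUOTIENT character is
  non-trivial on `Γ_K`: the non-anomalous clause (ii) «`D_𝔓` does not act trivially on `E[3]/Φ`» transports to the
  decomposition group `decomp 𝔭 ≤ Γ_K` of the degree-one prime `𝔭`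
  (K1 lineage, `…LineBaseChange.not_forall_decomp_smul_sub_mem`), and `θquot(g) = 1` would force `g` to act
  trivially modulo `Φ` (Teichmüller predicate: the scalar is `≡ 1 (mod 3)`). The SUB character is non-trivial on
  `Γ_K` by the tree's `restrictField_ne_one_of_isTeichmullerLiftOn` and [TOR] (now a theorem:
  `EisensteinCharacterInvariantsAtThreeCellTorsion.cell_noThreeTorsion_rational`);
* §3 `lambda_eq_of_characterCut` — hence `[θunr|_{G_K} = 𝟙] = 0` whichever member is the 3-unramified one, and
  [ALG] + [AN] + [BRram] + [BR𝟙] give `λ(X_{∅,0}(𝔭′)) = λ(L)` EXACTLY with `μ(L) = 0` (`FirstUnitCoeffAt L n ∧ λ(𝔛) = n`),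
  at odd `d_K`, WITHOUT K1 — CGLS Thm. 3.2.1's comparison on the wild cell, conditional on the displayed statements;
* §4 `eisensteinCharacterInvariantsAtThree_odd_of_print_of_characterCut` — with the route's PRINT item 26897
  (`CastellaGrossiLeeSkinner2022.prop14_residualCharacterSelmer_finite`, displayed as `hP`) the algebraic side is
  supplied by B1 (p616187 parts) and p609299 (`Ch·R₀⟦T⟧ = (g)`, `g` of norm profile `λ(𝔛)`), giving **K2 itself with
  the single extra binder `Odd (NumberField.discr K)`** (the scope of the typed Hida/Katz/BDP inputs; the kernel♯
  `LeopoldtKernelAtThreeOfPrint` applies K2 only after proving `Odd (discr K)` at its Friedberg–Hoffstein field).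

Displayed hypotheses and their status (binder types copied from p614352): `hloc` [LOC₃] (elementary local fact at
`p = 3`, to be discharged), `halg` [ALG] (CGLS Thm. 1.5.1 shape on the cell — print modulo port), `han` [AN] (the
additive Λ-adic Eisenstein congruence at `27 ∣ N` — the ONE unprinted statement), `hram` [BRram] (Rubin 1991 + Hida
2010 at the 3-ramified member through the functional equation — character level), `hbr`/`hF1` (K5 lineage shapes,
verbatim), `hP` (print). CONDITIONAL on them; nothing is asserted about any of them; closes nothing.
THEOREMS ONLY (no `def`, no `sorry`); standard axioms. BSD is not proved for any curve by any of this.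

References: [CastellaGrossiLeeSkinner2022] Thms. 1.2.2, 1.5.1, 2.2.1–2.2.4, 3.2.1 (arXiv:2008.02571v2);
[KellerYin2024] Thm. 1.2.2, proof of Thm. 3.0.8 (arXiv:2402.12781v2 TeX L1631–1640); [Rubin1991] Thm. 4.1;
[Hida2010MuInvariant] Thm. I; [GreenbergVatsal2000] §2 p. 28; HOME/bsd-line-chl-p1/K2PRIME-ROAD-chl-p1-g8.md.
-/

set_option autoImplicit false
-- `…BirchSwinnertonDyer.BirchSwinnertonDyer.Theorems…` is the problem's mandated namespace (D-0017).
set_option linter.dupNamespace false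

noncomputable section

open scoped Classical

namespace Summit.BirchSwinnertonDyer.BirchSwinnertonDyer.Theorems.EisensteinCharacterInvariantsAtThreeCharacterCutEq

open PowerSeries WeierstrassCurve NumberField IsDedekindDomain Field
  Literature.NumberTheory.EllipticCurves Literature.NumberTheory.EllipticCurves.ModularForms
  Literature.NumberTheory.EllipticCurves.Rank1Residual
  Literature.NumberTheory.EllipticCurves.KellerYin2024
  Literature.NumberTheory.EllipticCurves.GreenbergSelmer
  Literature.NumberTheory.GaloisRepresentations
  Summit.BirchSwinnertonDyer.Rank1Residual
  Summit.BirchSwinnertonDyer.Rank1Residual.X1.KellerYinMuLambdaSplit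
  Summit.BirchSwinnertonDyer.BirchSwinnertonDyer.Theorems.EisensteinPrimesMuLambda
  Summit.BirchSwinnertonDyer.BirchSwinnertonDyer.Theorems.CumulativeHeegnerInclusionAtThreeLineBaseChange
  Summit.BirchSwinnertonDyer.BirchSwinnertonDyer.Theorems.AdditiveKoly.SplitCompletion

/-! ## §1 The Teichmüller pair on a PRESCRIBED rational line -/

section Pair

variable (W : WeierstrassCurve ℚ) [W.IsElliptic] (p : ℕ) [hp : Fact p.Prime]

/-- **The Teichmüller pair `(ω̃, 𝟙̃)` of `G_ℚ` on a given rational `p`-line.** For `E/ℚ` and a rational `p`-line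
`Φ ≤ E[p](ℚ̄)` (`IsRationalLine`: order `p`, `G_ℚ`-stable) there are Teichmüller lifts `θsub`, `θquot : G_ℚ → GL₁(ℤ_p)`
of the characters of `G_ℚ` on `Φ` and on `E[p]/Φ` (`KellerYin2024.teichmullerLiftOnQuot`; `E[p](ℚ̄)` has order `p²`
and open point stabilisers). Same construction as `EisensteinPrimesMuLambda.exists_teichmullerPair`, which picks its
own line; here the line is prescribed (needed to read the cell's non-anomalous clause on THIS pair).
[cite: KellerYin2024, §1.4 (arXiv:2402.12781v2 TeX L1063–1086)] -/
theorem exists_teichmullerPair_of_line {Φ : AddSubgroup (geomTorsion W (p : ℤ))} (hΦ : IsRationalLine W p Φ) :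
    ∃ (θsub θquot : FramedGaloisRep ℚ (padicCoeffIntegers (∅ : Set (PadicAlgCl p))) 1),
      IsTeichmullerLiftOn (∅ : Set (PadicAlgCl p)) (Φ.map (geomTorsion W (p : ℤ)).subtype) θsub ∧
      IsTeichmullerLiftOnQuot (∅ : Set (PadicAlgCl p)) (Φ.map (geomTorsion W (p : ℤ)).subtype)
        (geomTorsion W (p : ℤ)) θquot := by
  obtain ⟨hcard, hstab⟩ := hΦ
  have hp0 : p ≠ 0 := hp.out.ne_zero
  -- stability of `T = E[p]`, `N = Φ` (read in `E(ℚ̄)`) and `⊥`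
  have hTstab : ∀ σ : absoluteGaloisGroup ℚ, ∀ P ∈ geomTorsion W (p : ℤ), σ • P ∈ geomTorsion W (p : ℤ) :=
    fun σ P hP ↦ by
    rw [mem_geomTorsion_iff] at hP ⊢
    rw [smul_comm, hP, smul_zero]
  have hNstab : ∀ σ : absoluteGaloisGroup ℚ, ∀ P ∈ Φ.map (geomTorsion W (p : ℤ)).subtype,
      σ • P ∈ Φ.map (geomTorsion W (p : ℤ)).subtype := by
    rintro σ _ ⟨P, hPmem, rfl⟩
    exact ⟨σ • P, hstab σ P hPmem, rfl⟩
  have hbot : ∀ σ : absoluteGaloisGroup ℚ, ∀ P ∈ (⊥ : AddSubgroup (geomPoints W)),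
      σ • P ∈ (⊥ : AddSubgroup (geomPoints W)) := fun σ P hP ↦ by
    rw [AddSubgroup.mem_bot] at hP ⊢; rw [hP, smul_zero]
  -- finiteness and open stabilisers
  have hTcard : Nat.card (geomTorsion W (p : ℤ)) = p ^ 2 :=
    card_torsionPoints_eq_sq_holds W (AlgebraicClosure ℚ) (n := p) (by exact_mod_cast hp0)
  have hTfin : (geomTorsion W (p : ℤ) : Set (geomPoints W)).Finite := by
    have : Finite (geomTorsion W (p : ℤ)) := Nat.finite_of_card_ne_zero (by rw [hTcard]; positivity)
    exact Set.toFinite _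
  have hle : Φ.map (geomTorsion W (p : ℤ)).subtype ≤ geomTorsion W (p : ℤ) := by
    rintro _ ⟨P, _, rfl⟩
    exact P.2
  have hNfin : (Φ.map (geomTorsion W (p : ℤ)).subtype : Set (geomPoints W)).Finite := hTfin.subset hle
  have hstabT : ∀ P ∈ geomTorsion W (p : ℤ),
      IsOpen ((MulAction.stabilizer (absoluteGaloisGroup ℚ) P : Subgroup _) : Set (absoluteGaloisGroup ℚ)) :=
    fun P _ ↦ isOpen_stabilizer_point_holds W P
  have hstabN : ∀ P ∈ Φ.map (geomTorsion W (p : ℤ)).subtype,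
      IsOpen ((MulAction.stabilizer (absoluteGaloisGroup ℚ) P : Subgroup _) : Set (absoluteGaloisGroup ℚ)) :=
    fun P hP ↦ hstabT P (hle hP)
  -- indices
  have hNcard : Nat.card (Φ.map (geomTorsion W (p : ℤ)).subtype) = p := by
    rw [Nat.card_congr (Φ.equivMapOfInjective (geomTorsion W (p : ℤ)).subtype
      (geomTorsion W (p : ℤ)).subtype_injective).toEquiv.symm, hcard]
  have hidx1 : (⊥ : AddSubgroup (geomPoints W)).relIndex (Φ.map (geomTorsion W (p : ℤ)).subtype) = p := by
    rw [AddSubgroup.relIndex_bot_left, hNcard]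
  have hidx2 : (Φ.map (geomTorsion W (p : ℤ)).subtype).relIndex (geomTorsion W (p : ℤ)) = p := by
    have h := AddSubgroup.relIndex_mul_relIndex (⊥ : AddSubgroup (geomPoints W))
      (Φ.map (geomTorsion W (p : ℤ)).subtype) (geomTorsion W (p : ℤ)) bot_le hle
    rw [hidx1, AddSubgroup.relIndex_bot_left, hTcard, sq] at h
    exact Nat.eq_of_mul_eq_mul_left hp.out.pos h
  exact ⟨teichmullerLiftOnQuot ∅ hbot hNstab hidx1 hNfin hstabN,
    teichmullerLiftOnQuot ∅ hNstab hTstab hidx2 hTfin hstabT,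
    isTeichmullerLiftOnQuot_teichmullerLiftOnQuot ∅ hbot hNstab hidx1 hNfin hstabN,
    isTeichmullerLiftOnQuot_teichmullerLiftOnQuot ∅ hNstab hTstab hidx2 hTfin hstabT⟩

end Pair

/-! ## §2 On the Leopoldt cell the quotient character is non-trivial on `Γ_K` -/

section Nontrivial

variable (W : WeierstrassCurve ℚ) [W.IsElliptic] (K : Type) [Field K] [NumberField K]

/-- **`θquot|_{Γ_K} ≠ 𝟙` on the Leopoldt cell.** Let `Φ ≤ E[3]` be a rational line whose non-anomalous clause (ii)
holds at every prime `𝔓` of `\bar ℤ` above `3` («`D_𝔓` does not act trivially on `E[3]/Φ`»), `K` an imaginary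
quadratic field (Galois over `ℚ`) with a DEGREE-ONE prime `𝔭 ∋ 3` (`e = f = 1`), and `θquot : G_ℚ → GL₁(ℤ₃)` the
Teichmüller lift of the character on `E[3]/Φ`. Then `θquot` is non-trivial on `Γ_K`: by the K1 lineage's transport
(`…LineBaseChange.not_forall_decomp_smul_sub_mem`) some `γ ∈ decomp 𝔭 ≤ Γ_K` acts non-trivially modulo `Φ` through
`res : Γ_K → G_ℚ`, whereas `θquot(res γ) = 1` would make its scalar `≡ 1 (mod 3)`, i.e. the action trivial modulo `Φ`.
[cite: GreenbergVatsal2000, §2 p. 28] [cite: KellerYin2024, §1.4 (arXiv:2402.12781v2 TeX L1063–1086)]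
[cite: NeukirchANT1999, Ch. I §9 (9.4)–(9.6)] -/
theorem restrictField_ne_one_of_isTeichmullerLiftOnQuot_of_cell (hK : IsImaginaryQuadratic K)
    {Φ : AddSubgroup (geomTorsion W ((3 : ℕ) : ℤ))}
    (hcell : ∀ (v : HeightOneSpectrum (𝓞 ℚ)), ((3 : ℕ) : 𝓞 ℚ) ∈ v.asIdeal → ∀ 𝔓 ∈ v.primesAbove,
      ¬ (∀ g ∈ 𝔓.decompositionSubgroup (absoluteGaloisGroup ℚ),
        ∀ P : geomTorsion W ((3 : ℕ) : ℤ), g • P - P ∈ Φ))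
    (𝔭 : HeightOneSpectrum (𝓞 K)) (h𝔭 : ((3 : ℕ) : 𝓞 K) ∈ 𝔭.asIdeal)
    (he : 𝔭.asIdeal.ramificationIdx (𝓞 ℚ) = 1) (hf : 𝔭.asIdeal.inertiaDeg (𝓞 ℚ) = 1)
    {θquot : FramedGaloisRep ℚ (padicCoeffIntegers (∅ : Set (PadicAlgCl 3))) 1}
    (hquot : IsTeichmullerLiftOnQuot (∅ : Set (PadicAlgCl 3)) (Φ.map (geomTorsion W ((3 : ℕ) : ℤ)).subtype)
      (geomTorsion W ((3 : ℕ) : ℤ)) θquot) :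
    ∃ σ : absoluteGaloisGroup K, θquot.restrictField K σ ≠ 1 := by
  haveI : Fact (Nat.Prime 3) := ⟨Nat.prime_three⟩
  haveI : IsGalois ℚ K := isGalois_of_finrank_eq_two K hK.1
  -- the place of `ℚ` below `𝔭`
  set v₃ : HeightOneSpectrum (𝓞 ℚ) := 𝔭.under (𝓞 ℚ) with hv₃
  have hw : 𝔭.asIdeal.under (𝓞 ℚ) = v₃.asIdeal := by rw [hv₃, HeightOneSpectrum.under_asIdeal]
  have h3v : ((3 : ℕ) : 𝓞 ℚ) ∈ v₃.asIdeal := natCast_mem_under K 3 𝔭 h𝔭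
  -- clause (ii) on `decomp 𝔭`
  have hnon : ¬ ∀ γ ∈ decomp 𝔭, ∀ P : W.geomTorsion ((3 : ℕ) : ℤ), absGaloisRestrict ℚ K γ • P - P ∈ Φ :=
    not_forall_decomp_smul_sub_mem K Φ hw he hf (hcell v₃ h3v)
  by_contra hall
  push Not at hall
  apply hnon
  intro γ _ P
  obtain ⟨a, ha, hmem⟩ := hquot.2 (absGaloisRestrict ℚ K γ)
  have h1 : θquot (absGaloisRestrict ℚ K γ) = 1 := by
    rw [← FramedGaloisRep.restrictField_apply]; exact hall γ
  have hea : ((entry (∅ : Set (PadicAlgCl 3)) θquot (absGaloisRestrict ℚ K γ) :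
      padicCoeffIntegers (∅ : Set (PadicAlgCl 3))) : PadicAlgCl 3) = 1 := by
    rw [entry_eq_one_of_apply_eq_one (∅ : Set (PadicAlgCl 3)) θquot h1, OneMemClass.coe_one]
  rw [hea, ← norm_neg, neg_sub, show (a : PadicAlgCl 3) - 1 = (((a - 1 : ℤ) : ℚ_[3]) : PadicAlgCl 3) by
    push_cast; rfl, PadicAlgCl.norm_extends, Padic.norm_intCast_lt_one_iff] at ha
  obtain ⟨c, hc⟩ := ha
  -- `a • P = P` on `3`-torsion
  have hPp : ((3 : ℕ) : ℤ) • (P : geomPoints W) = 0 := (mem_geomTorsion_iff W _ _).mp P.2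
  have haP : a • (P : geomPoints W) = P := by
    rw [show a = 1 + c * ((3 : ℕ) : ℤ) by rw [mul_comm, ← hc]; ring, add_smul, one_smul, mul_smul, hPp,
      smul_zero, add_zero]
  -- the Teichmüller predicate: `res γ • P - a • P ∈ Φ`
  obtain ⟨Q, hQ, hQeq⟩ := hmem (P : geomPoints W) P.2
  rw [haP] at hQeq
  have hPQ : absGaloisRestrict ℚ K γ • P - P = Q := by
    apply Subtype.ext
    rw [AddSubgroupClass.coe_sub, AddSubgroup.torsionBy.coe_smul, ← hQeq]
    rfl
  rw [hPQ]
  exact hQ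

end Nontrivial

/-! ## §3 The character cut with EQUALITY of the λ-invariants (no K1) -/

/-- **`λ_alg = λ_an` and `μ_an = 0` on the Leopoldt cell at odd `d_K`, from the character cut.** Displayed
hypotheses (binder types = those of p614352 VERBATIM): `hloc` [LOC₃], `halg` [ALG], `han` [AN], `hram` [BRram],
`hbr` = `CharMainConjOnTree 3`, `hF1` = `KatzLFunctionExistsFor 3`; [TOR] is now the theorem
`EisensteinCharacterInvariantsAtThreeCellTorsion.cell_noThreeTorsion_rational`. Conclusion: at every BDP frame `L` of
the cell, `L` has a first unit coefficient at some `n` AND `λ(X_{∅,0}(𝔭′)) = n` — the Eisenstein comparison proper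
(CGLS Thm. 3.2.1 transplanted): the pair is taken on the cell's line (§1), [BR𝟙] at the 3-unramified member has no
`+1` because that member is non-trivial on `Γ_K` (§2, resp. the tree's sub-character lemma with [TOR]), [BRram] at
the other member, and the local sums of [ALG]/[AN] cancel (`omega`). CONDITIONAL; closes nothing.
[cite: CastellaGrossiLeeSkinner2022, Thm. 1.5.1, Thm. 2.2.2 with (2.16), Thm. 2.2.4, Thm. 3.2.1]
[cite: KellerYin2024, proof of Thm. 3.0.8 (arXiv:2402.12781v2 TeX L1631–1640)] -/
theorem lambda_eq_of_characterCut
    (hloc : ∀ (W : WeierstrassCurve ℚ) [W.IsElliptic] [W.IsGloballyMinimal], Summit.BirchSwinnertonDyer.Rank1Residual.Additive.ClassO6 W 3 → Literature.NumberTheory.EllipticCurves.Rank1Residual.Red W 3 → (∃ Φ : AddSubgroup (WeierstrassCurve.geomTorsion W ((3 : ℕ) : ℤ)), Literature.NumberTheory.EllipticCurves.Rank1Residual.IsRationalLine W 3 Φ ∧ ∀ (v : IsDedekindDomain.HeightOneSpectrum (NumberField.RingOfIntegers ℚ)), ((3 : ℕ) : NumberField.RingOfIntegers ℚ) ∈ v.asIdeal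 → ∀ 𝔓 ∈ v.primesAbove, ¬ (∀ g ∈ 𝔓.decompositionSubgroup (Field.absoluteGaloisGroup ℚ), ∀ P ∈ Φ, g • P = P) ∧ ¬ (∀ g ∈ 𝔓.decompositionSubgroup (Field.absoluteGaloisGroup ℚ), ∀ P : WeierstrassCurve.geomTorsion W ((3 : ℕ) : ℤ), g • P - P ∈ Φ)) → ∀ (Φ : AddSubgroup (WeierstrassCurve.geomTorsion W ((3 : ℕ) : ℤ))), Literature.NumberTheory.EllipticCurves.Rank1Residual.IsRationalLine W 3 Φ → ∀ (θsub θquot : FramedGaloisRep ℚ (padicCoeffIntegers (∅ : Set (PadicAlgCl 3))) 1), Literature.NumberTheory.EllipticCurves.KellerYin2024.IsTeichmullerLiftOn (∅ : Set (PadicAlgCl 3)) (Φ.map (WeierstrassCurve.geomTorsion W ((3 : ℕ) : ℤ)).subtype) θsub → Literature.NumberTheory.EllipticCurves.KellerYin2024.IsTeichmullerLiftOnQuot (∅ : Set (PadicAlgCl 3)) (Φ.map (WeierstrassCurve.geomTorsion W ((3 : ℕ) : ℤ)).subtype) (WeierstrassCurve.geomTorsion W ((3 : ℕ) : ℤ))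 θquot → (∀ u : IsDedekindDomain.HeightOneSpectrum (NumberField.RingOfIntegers ℚ), ((3 : ℕ) : NumberField.RingOfIntegers ℚ) ∈ u.asIdeal → θsub.IsUnramifiedAt u) ∨ (∀ u : IsDedekindDomain.HeightOneSpectrum (NumberField.RingOfIntegers ℚ), ((3 : ℕ) : NumberField.RingOfIntegers ℚ) ∈ u.asIdeal → θquot.IsUnramifiedAt u))
    (halg : ∀ (W : WeierstrassCurve ℚ) [W.IsElliptic] [W.IsGloballyMinimal] (N : ℕ) [NeZero N] (K : Type) [Field K] [NumberField K], Summit.BirchSwinnertonDyer.Rank1Residual.Additive.ClassO6 W 3 → Literature.NumberTheory.EllipticCurves.Rank1Residual.Red W 3 → (∃ Φ : AddSubgroup (WeierstrassCurve.geomTorsion W ((3 : ℕ) : ℤ)), Literature.NumberTheory.EllipticCurves.Rank1Residual.IsRationalLine W 3 Φ ∧ ∀ (v : IsDedekindDomain.HeightOneSpectrum (NumberField.RingOfIntegers ℚ)), ((3 : ℕ) : NumberField.RingOfIntegers ℚ) ∈ v.asIdeal → ∀ 𝔓 ∈ v.primesAbove, ¬ (∀ g ∈ 𝔓.decompositionSubgroup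 (Field.absoluteGaloisGroup ℚ), ∀ P ∈ Φ, g • P = P) ∧ ¬ (∀ g ∈ 𝔓.decompositionSubgroup (Field.absoluteGaloisGroup ℚ), ∀ P : WeierstrassCurve.geomTorsion W ((3 : ℕ) : ℤ), g • P - P ∈ Φ)) → W.conductorNorm ℤ = N → Literature.NumberTheory.EllipticCurves.IsImaginaryQuadratic K → Literature.NumberTheory.EllipticCurves.SatisfiesHeegnerHypothesis N K → Odd (NumberField.discr K) → (∀ Q : (W.baseChange K).toAffine.Point, (3 : ℕ) • Q = 0 → Q = 0) → ∀ (κ : Literature.NumberTheory.EllipticCurves.ZpExtension K 3), κ.IsAnticyclotomic → ∀ (γ : Field.absoluteGaloisGroup K) [Fact (κ.IsTopGenerator γ)] (𝔭 : IsDedekindDomain.HeightOneSpectrum (NumberField.RingOfIntegers K)), ((3 : ℕ) : NumberField.RingOfIntegers K) ∈ 𝔭.asIdeal → 𝔭.asIdeal.ramificationIdx (NumberField.RingOfIntegers ℚ) = 1 → 𝔭.asIdeal.inertiaDeg (NumberField.RingOfIntegers ℚ) = 1 → ∀ (𝔭' : IsDedekindDomain.HeightOneSpectrum (NumberField.RingOfIntegers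 K)), ((3 : ℕ) : NumberField.RingOfIntegers K) ∈ 𝔭'.asIdeal → 𝔭' ≠ 𝔭 → ∀ (θsub θquot : FramedGaloisRep K (padicCoeffIntegers (∅ : Set (PadicAlgCl 3))) 1), Literature.NumberTheory.EllipticCurves.KellerYin2024.IsResidualPairOver (W.baseChange K) 3 θsub θquot → ∀ (Sf : Finset (IsDedekindDomain.HeightOneSpectrum (NumberField.RingOfIntegers K))), (∀ w : IsDedekindDomain.HeightOneSpectrum (NumberField.RingOfIntegers K), w ∈ Sf ↔ ((W.conductorNorm ℤ : ℤ) : NumberField.RingOfIntegers K) ∈ w.asIdeal) → ∀ (Dsub : Literature.NumberTheory.EllipticCurves.GreenbergVatsal2000.DatumDualData κ γ (Literature.NumberTheory.EllipticCurves.KellerYin2024.charModule (∅ : Set (PadicAlgCl 3)) θsub) (Literature.NumberTheory.EllipticCurves.Castella2018.AcSelmer.bdpData (Literature.NumberTheory.EllipticCurves.KellerYin2024.charModule (∅ : Set (PadicAlgCl 3)) θsub) 3 𝔭') ∅) (Dquot : Literature.NumberTheory.EllipticCurves.GreenbergVatsal2000.DatumDualData κ γ (Literature.NumberTheory.EllipticCurves.KellerYin2024.charModule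 (∅ : Set (PadicAlgCl 3)) θquot) (Literature.NumberTheory.EllipticCurves.Castella2018.AcSelmer.bdpData (Literature.NumberTheory.EllipticCurves.KellerYin2024.charModule (∅ : Set (PadicAlgCl 3)) θquot) 3 𝔭') ∅), Module.Finite (Literature.NumberTheory.EllipticCurves.IwasawaAlgebra 3) (Summit.BirchSwinnertonDyer.Rank1Residual.X11b.AcSelmer.XAc (W.baseChange K) 3 κ 𝔭' ∅ γ) ∧ Module.IsTorsion (Literature.NumberTheory.EllipticCurves.IwasawaAlgebra 3) (Summit.BirchSwinnertonDyer.Rank1Residual.X11b.AcSelmer.XAc (W.baseChange K) 3 κ 𝔭' ∅ γ) ∧ Literature.NumberTheory.EllipticCurves.muInvariant 3 (Summit.BirchSwinnertonDyer.Rank1Residual.X11b.AcSelmer.XAc (W.baseChange K) 3 κ 𝔭' ∅ γ) = 0 ∧ Literature.NumberTheory.EllipticCurves.lambdaInvariant 3 (Summit.BirchSwinnertonDyer.Rank1Residual.X11b.AcSelmer.XAc (W.baseChange K) 3 κ 𝔭' ∅ γ) + ∑ w ∈ Sf, Literature.NumberTheory.EllipticCurves.KellerYin2024.curveLocalLambda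 κ (W.baseChange K) w = Literature.NumberTheory.EllipticCurves.lambdaInvariant 3 Dsub.X + Literature.NumberTheory.EllipticCurves.lambdaInvariant 3 Dquot.X + ∑ w ∈ Sf, (Literature.NumberTheory.EllipticCurves.KellerYin2024.charLocalLambda (∅ : Set (PadicAlgCl 3)) κ θsub w + Literature.NumberTheory.EllipticCurves.KellerYin2024.charLocalLambda (∅ : Set (PadicAlgCl 3)) κ θquot w))
    (han : ∀ (W : WeierstrassCurve ℚ) [W.IsElliptic] [W.IsGloballyMinimal] (N : ℕ) [NeZero N] (K : Type) [Field K] [NumberField K] (Dt : Literature.NumberTheory.EllipticCurves.ModularForms.ModularParametrizationData W N), Summit.BirchSwinnertonDyer.Rank1Residual.Additive.ClassO6 W 3 → Literature.NumberTheory.EllipticCurves.Rank1Residual.Red W 3 → (∃ Φ : AddSubgroup (WeierstrassCurve.geomTorsion W ((3 : ℕ) : ℤ)), Literature.NumberTheory.EllipticCurves.Rank1Residual.IsRationalLine W 3 Φ ∧ ∀ (v : IsDedekindDomain.HeightOneSpectrum (NumberField.RingOfIntegers ℚ)), ((3 : ℕ) : NumberField.RingOfIntegers ℚ) ∈ v.asIdeal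 → ∀ 𝔓 ∈ v.primesAbove, ¬ (∀ g ∈ 𝔓.decompositionSubgroup (Field.absoluteGaloisGroup ℚ), ∀ P ∈ Φ, g • P = P) ∧ ¬ (∀ g ∈ 𝔓.decompositionSubgroup (Field.absoluteGaloisGroup ℚ), ∀ P : WeierstrassCurve.geomTorsion W ((3 : ℕ) : ℤ), g • P - P ∈ Φ)) → W.analyticRank = 1 → W.conductorNorm ℤ = N → Literature.NumberTheory.EllipticCurves.IsImaginaryQuadratic K → Literature.NumberTheory.EllipticCurves.SatisfiesHeegnerHypothesis N K → Odd (NumberField.discr K) → ∀ (κ : Literature.NumberTheory.EllipticCurves.ZpExtension K 3), κ.IsAnticyclotomic → ∀ (γ : Field.absoluteGaloisGroup K) [Fact (κ.IsTopGenerator γ)] (𝔭 : IsDedekindDomain.HeightOneSpectrum (NumberField.RingOfIntegers K)), ((3 : ℕ) : NumberField.RingOfIntegers K) ∈ 𝔭.asIdeal → 𝔭.asIdeal.ramificationIdx (NumberField.RingOfIntegers ℚ) = 1 → 𝔭.asIdeal.inertiaDeg (NumberField.RingOfIntegers ℚ) = 1 → ∀ (𝔭' : IsDedekindDomain.HeightOneSpectrum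 (NumberField.RingOfIntegers K)), ((3 : ℕ) : NumberField.RingOfIntegers K) ∈ 𝔭'.asIdeal → 𝔭' ≠ 𝔭 → ∀ (ι' : PadicAlgCl 3 ≃+* ℂ), Summit.BirchSwinnertonDyer.BirchSwinnertonDyer.Theorems.SchneiderFree.BranchInducesPrime 3 ι' 𝔭 → ∀ (ΩK : ℂ) (Ωp : ℂ_[3]) (L : Literature.NumberTheory.EllipticCurves.UnrSeries 3), ΩK ≠ 0 → Ωp ≠ 0 → Literature.NumberTheory.EllipticCurves.IsBDPLFunction ι' 𝔭 κ γ Dt.f ΩK Ωp L → ∀ (θsub θquot : FramedGaloisRep ℚ (padicCoeffIntegers (∅ : Set (PadicAlgCl 3))) 1), Literature.NumberTheory.EllipticCurves.KellerYin2024.IsResidualPairOver (W.baseChange K) 3 (θsub.restrictField K) (θquot.restrictField K) → ∀ (θunr : FramedGaloisRep ℚ (padicCoeffIntegers (∅ : Set (PadicAlgCl 3))) 1), (θunr = θsub ∨ θunr = θquot) → (∀ u : IsDedekindDomain.HeightOneSpectrum (NumberField.RingOfIntegers ℚ), ((3 : ℕ) : NumberField.RingOfIntegers ℚ) ∈ u.asIdeal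 → θunr.IsUnramifiedAt u) → ∀ (Sf : Finset (IsDedekindDomain.HeightOneSpectrum (NumberField.RingOfIntegers K))), (∀ w : IsDedekindDomain.HeightOneSpectrum (NumberField.RingOfIntegers K), w ∈ Sf ↔ ((W.conductorNorm ℤ : ℤ) : NumberField.RingOfIntegers K) ∈ w.asIdeal) → ∀ (θK : HeckeCharacter K), Literature.NumberTheory.EllipticCurves.KellerYin2024.IsHeckeCharOf ι' (θunr.restrictField K) θK → ∀ (Cbar : Finset (IsDedekindDomain.HeightOneSpectrum (NumberField.RingOfIntegers K))), (∀ u ∈ Cbar, ¬ θK.IsUnramifiedAt u) → ∀ (ΩK' : ℂ) (Ωp' : (Literature.NumberTheory.EllipticCurves.unrIntegers 3)ˣ) (Lφ : Literature.NumberTheory.EllipticCurves.UnrSeries 3), ΩK' ≠ 0 → Literature.NumberTheory.EllipticCurves.CastellaGrossiLeeSkinner2022.IsKatzLFunction ι' 𝔭 𝔭' Cbar κ γ θK ΩK' ((Ωp' : Literature.NumberTheory.EllipticCurves.unrIntegers 3) : ℂ_[3]) Lφ → ∃ n nφ : ℕ, Literature.NumberTheory.EllipticCurves.KellerYin2024.FirstUnitCoeffAt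 L n ∧ Literature.NumberTheory.EllipticCurves.KellerYin2024.FirstUnitCoeffAt Lφ nφ ∧ n + ∑ w ∈ Sf, Literature.NumberTheory.EllipticCurves.KellerYin2024.curveLocalLambda κ (W.baseChange K) w = 2 * nφ + ∑ w ∈ Sf, (Literature.NumberTheory.EllipticCurves.KellerYin2024.charLocalLambda (∅ : Set (PadicAlgCl 3)) κ (θsub.restrictField K) w + Literature.NumberTheory.EllipticCurves.KellerYin2024.charLocalLambda (∅ : Set (PadicAlgCl 3)) κ (θquot.restrictField K) w))
    (hram : ∀ (W : WeierstrassCurve ℚ) [W.IsElliptic] [W.IsGloballyMinimal] (N : ℕ) [NeZero N] (K : Type) [Field K] [NumberField K], Summit.BirchSwinnertonDyer.Rank1Residual.Additive.ClassO6 W 3 → Literature.NumberTheory.EllipticCurves.Rank1Residual.Red W 3 → (∃ Φ : AddSubgroup (WeierstrassCurve.geomTorsion W ((3 : ℕ) : ℤ)), Literature.NumberTheory.EllipticCurves.Rank1Residual.IsRationalLine W 3 Φ ∧ ∀ (v : IsDedekindDomain.HeightOneSpectrum (NumberField.RingOfIntegers ℚ)), ((3 : ℕ) : NumberField.RingOfIntegers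 ℚ) ∈ v.asIdeal → ∀ 𝔓 ∈ v.primesAbove, ¬ (∀ g ∈ 𝔓.decompositionSubgroup (Field.absoluteGaloisGroup ℚ), ∀ P ∈ Φ, g • P = P) ∧ ¬ (∀ g ∈ 𝔓.decompositionSubgroup (Field.absoluteGaloisGroup ℚ), ∀ P : WeierstrassCurve.geomTorsion W ((3 : ℕ) : ℤ), g • P - P ∈ Φ)) → W.conductorNorm ℤ = N → Literature.NumberTheory.EllipticCurves.IsImaginaryQuadratic K → Literature.NumberTheory.EllipticCurves.SatisfiesHeegnerHypothesis N K → Odd (NumberField.discr K) → (∀ Q : (W.baseChange K).toAffine.Point, (3 : ℕ) • Q = 0 → Q = 0) → ∀ (κ : Literature.NumberTheory.EllipticCurves.ZpExtension K 3), κ.IsAnticyclotomic → ∀ (γ : Field.absoluteGaloisGroup K) [Fact (κ.IsTopGenerator γ)] (𝔭 : IsDedekindDomain.HeightOneSpectrum (NumberField.RingOfIntegers K)), ((3 : ℕ) : NumberField.RingOfIntegers K) ∈ 𝔭.asIdeal → 𝔭.asIdeal.ramificationIdx (NumberField.RingOfIntegers ℚ) = 1 → 𝔭.asIdeal.inertiaDeg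 (NumberField.RingOfIntegers ℚ) = 1 → ∀ (𝔭' : IsDedekindDomain.HeightOneSpectrum (NumberField.RingOfIntegers K)), ((3 : ℕ) : NumberField.RingOfIntegers K) ∈ 𝔭'.asIdeal → 𝔭' ≠ 𝔭 → ∀ (ι' : PadicAlgCl 3 ≃+* ℂ), Summit.BirchSwinnertonDyer.BirchSwinnertonDyer.Theorems.SchneiderFree.BranchInducesPrime 3 ι' 𝔭 → ∀ (Φ : AddSubgroup (WeierstrassCurve.geomTorsion W ((3 : ℕ) : ℤ))), Literature.NumberTheory.EllipticCurves.Rank1Residual.IsRationalLine W 3 Φ → ∀ (θsub θquot : FramedGaloisRep ℚ (padicCoeffIntegers (∅ : Set (PadicAlgCl 3))) 1), Literature.NumberTheory.EllipticCurves.KellerYin2024.IsTeichmullerLiftOn (∅ : Set (PadicAlgCl 3)) (Φ.map (WeierstrassCurve.geomTorsion W ((3 : ℕ) : ℤ)).subtype) θsub → Literature.NumberTheory.EllipticCurves.KellerYin2024.IsTeichmullerLiftOnQuot (∅ : Set (PadicAlgCl 3)) (Φ.map (WeierstrassCurve.geomTorsion W ((3 : ℕ) : ℤ)).subtype) (WeierstrassCurve.geomTorsion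 W ((3 : ℕ) : ℤ)) θquot → ∀ (θunr θram : FramedGaloisRep ℚ (padicCoeffIntegers (∅ : Set (PadicAlgCl 3))) 1), ((θunr = θsub ∧ θram = θquot) ∨ (θunr = θquot ∧ θram = θsub)) → (∀ u : IsDedekindDomain.HeightOneSpectrum (NumberField.RingOfIntegers ℚ), ((3 : ℕ) : NumberField.RingOfIntegers ℚ) ∈ u.asIdeal → θunr.IsUnramifiedAt u) → ∀ (θK : HeckeCharacter K), Literature.NumberTheory.EllipticCurves.KellerYin2024.IsHeckeCharOf ι' (θunr.restrictField K) θK → ∀ (Cbar : Finset (IsDedekindDomain.HeightOneSpectrum (NumberField.RingOfIntegers K))), (∀ u ∈ Cbar, ¬ θK.IsUnramifiedAt u) → ∀ (ΩK' : ℂ) (Ωp' : (Literature.NumberTheory.EllipticCurves.unrIntegers 3)ˣ) (Lφ : Literature.NumberTheory.EllipticCurves.UnrSeries 3), ΩK' ≠ 0 → Literature.NumberTheory.EllipticCurves.CastellaGrossiLeeSkinner2022.IsKatzLFunction ι' 𝔭 𝔭' Cbar κ γ θK ΩK' ((Ωp' : Literature.NumberTheory.EllipticCurves.unrIntegers 3)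 : ℂ_[3]) Lφ → ∀ nφ : ℕ, Literature.NumberTheory.EllipticCurves.KellerYin2024.FirstUnitCoeffAt Lφ nφ → ∀ (Dram : Literature.NumberTheory.EllipticCurves.GreenbergVatsal2000.DatumDualData κ γ (Literature.NumberTheory.EllipticCurves.KellerYin2024.charModule (∅ : Set (PadicAlgCl 3)) (θram.restrictField K)) (Literature.NumberTheory.EllipticCurves.Castella2018.AcSelmer.bdpData (Literature.NumberTheory.EllipticCurves.KellerYin2024.charModule (∅ : Set (PadicAlgCl 3)) (θram.restrictField K)) 3 𝔭') ∅), Module.Finite (Literature.NumberTheory.EllipticCurves.IwasawaAlgebra 3) Dram.X ∧ Module.IsTorsion (Literature.NumberTheory.EllipticCurves.IwasawaAlgebra 3) Dram.X ∧ Literature.NumberTheory.EllipticCurves.muInvariant 3 Dram.X = 0 ∧ Literature.NumberTheory.EllipticCurves.lambdaInvariant 3 Dram.X = nφ)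
    (hbr : CharMainConjOnTree 3) (hF1 : KatzLFunctionExistsFor 3) :
    ∀ (W : WeierstrassCurve ℚ) [W.IsElliptic] [W.IsGloballyMinimal] (N : ℕ) [NeZero N] (K : Type) [Field K] [NumberField K] (Dt : Literature.NumberTheory.EllipticCurves.ModularForms.ModularParametrizationData W N), Summit.BirchSwinnertonDyer.Rank1Residual.Additive.ClassO6 W 3 → Literature.NumberTheory.EllipticCurves.Rank1Residual.Red W 3 → (∃ Φ : AddSubgroup (WeierstrassCurve.geomTorsion W ((3 : ℕ) : ℤ)), Literature.NumberTheory.EllipticCurves.Rank1Residual.IsRationalLine W 3 Φ ∧ ∀ (v : IsDedekindDomain.HeightOneSpectrum (NumberField.RingOfIntegers ℚ)), ((3 : ℕ) : NumberField.RingOfIntegers ℚ) ∈ v.asIdeal → ∀ 𝔓 ∈ v.primesAbove, ¬ (∀ g ∈ 𝔓.decompositionSubgroup (Field.absoluteGaloisGroup ℚ), ∀ P ∈ Φ, g • P = P) ∧ ¬ (∀ g ∈ 𝔓.decompositionSubgroup (Field.absoluteGaloisGroup ℚ), ∀ P : WeierstrassCurve.geomTorsion W ((3 : ℕ) : ℤ),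 g • P - P ∈ Φ)) → W.analyticRank = 1 → W.conductorNorm ℤ = N → Literature.NumberTheory.EllipticCurves.IsImaginaryQuadratic K → Literature.NumberTheory.EllipticCurves.SatisfiesHeegnerHypothesis N K → Odd (NumberField.discr K) → ∀ (κ : Literature.NumberTheory.EllipticCurves.ZpExtension K 3), κ.IsAnticyclotomic → ∀ (γ : Field.absoluteGaloisGroup K) [Fact (κ.IsTopGenerator γ)] (𝔭 : IsDedekindDomain.HeightOneSpectrum (NumberField.RingOfIntegers K)), ((3 : ℕ) : NumberField.RingOfIntegers K) ∈ 𝔭.asIdeal → 𝔭.asIdeal.ramificationIdx (NumberField.RingOfIntegers ℚ) = 1 → 𝔭.asIdeal.inertiaDeg (NumberField.RingOfIntegers ℚ) = 1 → ∀ (𝔭' : IsDedekindDomain.HeightOneSpectrum (NumberField.RingOfIntegers K)), ((3 : ℕ) : NumberField.RingOfIntegers K) ∈ 𝔭'.asIdeal → 𝔭' ≠ 𝔭 → ∀ (ι' : PadicAlgCl 3 ≃+* ℂ), Summit.BirchSwinnertonDyer.BirchSwinnertonDyer.Theorems.SchneiderFree.BranchInducesPrime 3 ι' 𝔭 → ∀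 (ΩK : ℂ) (Ωp : ℂ_[3]) (L : Literature.NumberTheory.EllipticCurves.UnrSeries 3), ΩK ≠ 0 → Ωp ≠ 0 → Literature.NumberTheory.EllipticCurves.IsBDPLFunction ι' 𝔭 κ γ Dt.f ΩK Ωp L → ∃ n : ℕ, Literature.NumberTheory.EllipticCurves.KellerYin2024.FirstUnitCoeffAt L n ∧ Literature.NumberTheory.EllipticCurves.lambdaInvariant 3 (Summit.BirchSwinnertonDyer.Rank1Residual.X11b.AcSelmer.XAc (W.baseChange K) 3 κ 𝔭' ∅ γ) = n := by
  intro W _ _ N _ K _ _ Dt hO6 hRed hcell hr hN hK hHN hodd κ hκ γ hγ 𝔭 h𝔭 he hf 𝔭' h𝔭' hne ι' hι ΩK Ωp L hΩK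
    hΩp hBDP
  -- §0 frame data in the `bsd-eis` currency
  have hp : 2 < 3 := by norm_num
  have h3N : 3 ∣ W.conductorNorm ℤ :=
    (W.dvd_conductorNorm_iff_not_hasGoodReductionAtPrime 3).mpr (not_good_of_addv W 3 hO6.2.1)
  have hHW : SatisfiesHeegnerHypothesis (W.conductorNorm ℤ) K := by rw [hN]; exact hHN
  have hH3 : SatisfiesHeegnerHypothesis 3 K := SatisfiesHeegnerHypothesis.of_dvd h3N hHW
  have hd3 : NumberField.discr K ≠ -3 := by
    intro h
    exact (X11b.Three.not_dvd_discr_and_not_dvd_torsionOrder_of_heegner hK hHW (p := 3) (by decide) h3N).1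
      ⟨-1, by rw [h]; norm_num⟩
  have hv : ∀ x : 𝓞 K, x ∈ 𝔭.asIdeal ↔ ‖X11b.embAt K 3 𝔭 h𝔭 he hf (x : K)‖ < 1 :=
    X11b.mem_asIdeal_iff_norm_embAt_lt_one 𝔭 h𝔭 he hf
  have hι' : ∀ (w : InfinitePlace K) (k : 𝓞 K), k ∈ 𝔭.asIdeal ↔ ‖ι'.symm (w.embedding (k : K))‖ < 1 := hι
  have hEK : ∀ Q : (W.baseChange K).toAffine.Point, (3 : ℕ) • Q = 0 → Q = 0 :=
    EisensteinCharacterInvariantsAtThreeCellTorsion.cell_noThreeTorsion_rational W N K hO6 hRed hcell hN hK hHN 𝔭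
      h𝔭 he hf
  -- §1 the Teichmüller pair of `G_ℚ` ON THE CELL'S LINE, its restriction to `Γ_K`, the places over `N`
  obtain ⟨Φ, hΦ, hcellΦ⟩ := hcell
  obtain ⟨θsub, θquot, hsub, hquot⟩ := exists_teichmullerPair_of_line W 3 hΦ
  have hpair : IsResidualPairOver (W.baseChange K) 3 (θsub.restrictField K) (θquot.restrictField K) :=
    isResidualPairOver_restrictField W 3 K hΦ hsub hquot
  obtain ⟨Sf, hSf⟩ := exists_finset_places_dvd (K := K) (N := W.conductorNorm ℤ) (W.conductorNorm_pos_holds).ne'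
  have hTs : ∀ σ : absoluteGaloisGroup ℚ, θsub σ ^ (3 - 1) = 1 := hsub.1
  have hTq : ∀ σ : absoluteGaloisGroup ℚ, θquot σ ^ (3 - 1) = 1 := hquot.1
  have hTsK : ∀ σ : absoluteGaloisGroup K, θsub.restrictField K σ ^ (3 - 1) = 1 := fun σ ↦ hTs _
  have hTqK : ∀ σ : absoluteGaloisGroup K, θquot.restrictField K σ ^ (3 - 1) = 1 := fun σ ↦ hTq _
  have hcardΦ : Nat.card (Φ.map (geomTorsion W ((3 : ℕ) : ℤ)).subtype) = 3 := by
    rw [Nat.card_congr (Φ.equivMapOfInjective (geomTorsion W ((3 : ℕ) : ℤ)).subtype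
      (geomTorsion W ((3 : ℕ) : ℤ)).subtype_injective).toEquiv.symm, hΦ.1]
  have hleΦ : Φ.map (geomTorsion W ((3 : ℕ) : ℤ)).subtype ≤ geomTorsion W ((3 : ℕ) : ℤ) := by
    rintro P ⟨Q, -, rfl⟩
    exact Q.2
  -- the two members are NON-TRIVIAL on `Γ_K` (sub: `E(K)[3] = 0`; quot: the cell's clause (ii))
  have hnt_sub : ¬ ∀ σ : absoluteGaloisGroup K, θsub.restrictField K σ = 1 := by
    obtain ⟨σ, hσ⟩ := restrictField_ne_one_of_isTeichmullerLiftOn W (∅ : Set (PadicAlgCl 3)) hEK hcardΦ hleΦ hsub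
    exact fun h ↦ hσ (h σ)
  have hnt_quot : ¬ ∀ σ : absoluteGaloisGroup K, θquot.restrictField K σ = 1 := by
    obtain ⟨σ, hσ⟩ := restrictField_ne_one_of_isTeichmullerLiftOnQuot_of_cell W K hK
      (fun v hv 𝔓 h𝔓 ↦ (hcellΦ v hv 𝔓 h𝔓).2) 𝔭 h𝔭 he hf hquot
    exact fun h ↦ hσ (h σ)
  -- §2 Néron–Ogg–Shafarevich off `N` (note `3 ∣ N`, so `N ∉ u` forces `3 ∉ u`)
  have h3u : ∀ u : HeightOneSpectrum (𝓞 ℚ), ((W.conductorNorm ℤ : ℤ) : 𝓞 ℚ) ∉ u.asIdeal →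
      ((3 : ℕ) : 𝓞 ℚ) ∉ u.asIdeal := by
    intro u hu h3
    obtain ⟨c, hc⟩ := h3N
    exact hu (by rw [hc]; push_cast; exact u.asIdeal.mul_mem_right _ h3)
  have hunrN_sub : ∀ u : HeightOneSpectrum (𝓞 ℚ), ((W.conductorNorm ℤ : ℤ) : 𝓞 ℚ) ∉ u.asIdeal →
      θsub.IsUnramifiedAt u := fun u hu ↦
    isUnramifiedAt_of_isTeichmullerLiftOn W ∅ hcardΦ hleΦ hsub (hasGoodReductionAt_of_conductorNorm_notMem W u hu)
      (h3u u hu)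
  have hunrN_quot : ∀ u : HeightOneSpectrum (𝓞 ℚ), ((W.conductorNorm ℤ : ℤ) : 𝓞 ℚ) ∉ u.asIdeal →
      θquot.IsUnramifiedAt u := fun u hu ↦
    isUnramifiedAt_of_isTeichmullerLiftOnQuot W ∅ hcardΦ hquot (hasGoodReductionAt_of_conductorNorm_notMem W u hu)
      (h3u u hu)
  -- §3 the dual data of the two character Selmer groups (exist unconditionally)
  obtain ⟨Dsub⟩ := nonempty_unrDualData_char (∅ : Set (PadicAlgCl 3)) (θsub.restrictField K) κ 𝔭'
    (∅ : Set (HeightOneSpectrum (𝓞 K))) hγ.out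
  obtain ⟨Dquot⟩ := nonempty_unrDualData_char (∅ : Set (PadicAlgCl 3)) (θquot.restrictField K) κ 𝔭'
    (∅ : Set (HeightOneSpectrum (𝓞 K))) hγ.out
  -- §4 [ALG] (symmetric in the pair)
  obtain ⟨-, -, -, hXlam⟩ := halg W N K hO6 hRed ⟨Φ, hΦ, hcellΦ⟩ hN hK hHN hodd hEK κ hκ γ 𝔭 h𝔭 he hf 𝔭'
    h𝔭' hne (θsub.restrictField K) (θquot.restrictField K) hpair Sf hSf Dsub Dquot
  -- §5 case split on which member is unramified at `3` ([LOC₃])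
  rcases hloc W hO6 hRed ⟨Φ, hΦ, hcellΦ⟩ Φ hΦ θsub θquot hsub hquot with hunr3 | hunr3
  · -- `θunr = θsub`, `θram = θquot`
    obtain ⟨θK, -, hθK'⟩ := exists_heckeCharacter_of_pow_eq_one ∅ ι' (θsub.restrictField K) hTsK
    have hθK : IsHeckeCharOf ι' (θsub.restrictField K) θK := hθK'
    obtain ⟨ΩK₁, Ωp₁, L₁, hΩK₁, hL₁⟩ :=
      hF1 hp K hK hH3 hodd hd3 (X11b.embAt K 3 𝔭 h𝔭 he hf) 𝔭 𝔭' hv h𝔭' hne κ hκ γ ι' hι' θsub hTs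
        (W.conductorNorm ℤ) hHW hunrN_sub hunr3 θK hθK
    have hCb : ∀ u ∈ (∅ : Finset (HeightOneSpectrum (𝓞 K))), ¬ θK.IsUnramifiedAt u := by simp
    -- [BR𝟙] at `θsub` (no `+1`: `θsub|_{Γ_K} ≠ 𝟙`)
    obtain ⟨-, -, -, m₁, hm₁, hlam_unr⟩ := hbr hp K hK hH3 hodd hd3 (X11b.embAt K 3 𝔭 h𝔭 he hf) 𝔭 𝔭' hv h𝔭'
      hne κ hκ γ ι' hι' θsub hTs (W.conductorNorm ℤ) hHW hunrN_sub hunr3 θK hθK Dsub ∅ hCb ΩK₁ Ωp₁ L₁ hΩK₁ hL₁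
    rw [if_neg hnt_sub, add_zero] at hlam_unr
    -- [BRram] at `θquot`
    obtain ⟨-, -, -, hlam_ram⟩ := hram W N K hO6 hRed ⟨Φ, hΦ, hcellΦ⟩ hN hK hHN hodd hEK κ hκ γ 𝔭 h𝔭 he hf 𝔭'
      h𝔭' hne ι' hι Φ hΦ θsub θquot hsub hquot θsub θquot (Or.inl ⟨rfl, rfl⟩) hunr3 θK hθK ∅ hCb ΩK₁ Ωp₁ L₁ hΩK₁
      hL₁ m₁ hm₁ Dquot
    -- [AN]
    obtain ⟨n, m₁', hn, hm₁', hsum⟩ := han W N K Dt hO6 hRed ⟨Φ, hΦ, hcellΦ⟩ hr hN hK hHN hodd κ hκ γ 𝔭 h𝔭 he hf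
      𝔭' h𝔭' hne ι' hι ΩK Ωp L hΩK hΩp hBDP θsub θquot hpair θsub (Or.inl rfl) hunr3 Sf hSf θK hθK ∅ hCb ΩK₁ Ωp₁
      L₁ hΩK₁ hL₁
    have hmm : m₁' = m₁ := hm₁'.unique hm₁
    subst hmm
    refine ⟨n, hn, ?_⟩
    omega
  · -- `θunr = θquot`, `θram = θsub`
    obtain ⟨θK, -, hθK'⟩ := exists_heckeCharacter_of_pow_eq_one ∅ ι' (θquot.restrictField K) hTqK
    have hθK : IsHeckeCharOf ι' (θquot.restrictField K) θK := hθK'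
    obtain ⟨ΩK₁, Ωp₁, L₁, hΩK₁, hL₁⟩ :=
      hF1 hp K hK hH3 hodd hd3 (X11b.embAt K 3 𝔭 h𝔭 he hf) 𝔭 𝔭' hv h𝔭' hne κ hκ γ ι' hι' θquot hTq
        (W.conductorNorm ℤ) hHW hunrN_quot hunr3 θK hθK
    have hCb : ∀ u ∈ (∅ : Finset (HeightOneSpectrum (𝓞 K))), ¬ θK.IsUnramifiedAt u := by simp
    -- [BR𝟙] at `θquot` (no `+1`: `θquot|_{Γ_K} ≠ 𝟙` on the cell)
    obtain ⟨-, -, -, m₁, hm₁, hlam_unr⟩ := hbr hp K hK hH3 hodd hd3 (X11b.embAt K 3 𝔭 h𝔭 he hf) 𝔭 𝔭' hv h𝔭'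
      hne κ hκ γ ι' hι' θquot hTq (W.conductorNorm ℤ) hHW hunrN_quot hunr3 θK hθK Dquot ∅ hCb ΩK₁ Ωp₁ L₁ hΩK₁ hL₁
    rw [if_neg hnt_quot, add_zero] at hlam_unr
    -- [BRram] at `θsub`
    obtain ⟨-, -, -, hlam_ram⟩ := hram W N K hO6 hRed ⟨Φ, hΦ, hcellΦ⟩ hN hK hHN hodd hEK κ hκ γ 𝔭 h𝔭 he hf 𝔭'
      h𝔭' hne ι' hι Φ hΦ θsub θquot hsub hquot θquot θsub (Or.inr ⟨rfl, rfl⟩) hunr3 θK hθK ∅ hCb ΩK₁ Ωp₁ L₁ hΩK₁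
      hL₁ m₁ hm₁ Dsub
    -- [AN]
    obtain ⟨n, m₁', hn, hm₁', hsum⟩ := han W N K Dt hO6 hRed ⟨Φ, hΦ, hcellΦ⟩ hr hN hK hHN hodd κ hκ γ 𝔭 h𝔭 he hf
      𝔭' h𝔭' hne ι' hι ΩK Ωp L hΩK hΩp hBDP θsub θquot hpair θquot (Or.inr rfl) hunr3 Sf hSf θK hθK ∅ hCb ΩK₁ Ωp₁
      L₁ hΩK₁ hL₁
    have hmm : m₁' = m₁ := hm₁'.unique hm₁
    subst hmm
    refine ⟨n, hn, ?_⟩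
    omega

/-! ## §4 K2 at odd `d_K` from the print item and the character cut -/

/-- **K2 with the single extra binder `Odd (NumberField.discr K)`, from PRINT + the character cut.** `hP` = the
route's print item `ResidualSelmerPrintedInputAtThree` (stmt-26897) BY VALUE, i.e. the Literature named fact
`CastellaGrossiLeeSkinner2022.prop14_residualCharacterSelmer_finite` (CGLS 2022 Prop. 14 — unproved published input);
the other displayed hypotheses as in `lambda_eq_of_characterCut`. Conclusion = the route crux
`EisensteinCharacterInvariantsAtThree` (stmt-24199) with `Odd (NumberField.discr K) →` inserted after the Heegner
hypothesis: at every BDP frame of the Leopoldt cell, `Ch_Λ(X_{∅,0}(𝔭′))·R₀⟦T⟧ = (g)` with `g` and `L` both having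
their FIRST unit coefficient at the same index `n` (`μ_alg = μ_an = 0`, `λ_alg = λ_an`). Proof: print ⟹ B1
(p616187 parts) ⟹ `X` torsion and `Ch·R₀⟦T⟧ = (g)` with `g` of norm profile `λ(𝔛)` (p609299); §3 gives
`λ(𝔛) = n` and the profile of `L`. No use of K1. CONDITIONAL on the displayed statements ([AN] research;
[ALG]/[BRram]/[BR𝟙]/[F1b]/`hP` print or print-modulo-port; [LOC₃] elementary); closes nothing by itself.
[cite: CastellaGrossiLeeSkinner2022, §1.2 Prop. 14, Thm. 1.5.1, Thm. 2.2.4, Thm. 3.2.1]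
[cite: GreenbergLNM1716, §1 p. 60] [cite: Washington1997, §13.2] -/
theorem eisensteinCharacterInvariantsAtThree_odd_of_print_of_characterCut
    (hP : Literature.NumberTheory.EllipticCurves.CastellaGrossiLeeSkinner2022.prop14_residualCharacterSelmer_finite)
    (hloc : ∀ (W : WeierstrassCurve ℚ) [W.IsElliptic] [W.IsGloballyMinimal], Summit.BirchSwinnertonDyer.Rank1Residual.Additive.ClassO6 W 3 → Literature.NumberTheory.EllipticCurves.Rank1Residual.Red W 3 → (∃ Φ : AddSubgroup (WeierstrassCurve.geomTorsion W ((3 : ℕ) : ℤ)), Literature.NumberTheory.EllipticCurves.Rank1Residual.IsRationalLine W 3 Φ ∧ ∀ (v : IsDedekindDomain.HeightOneSpectrum (NumberField.RingOfIntegers ℚ)), ((3 : ℕ) : NumberField.RingOfIntegers ℚ) ∈ v.asIdeal → ∀ 𝔓 ∈ v.primesAbove, ¬ (∀ g ∈ 𝔓.decompositionSubgroup (Field.absoluteGaloisGroup ℚ), ∀ P ∈ Φ, g • P = P) ∧ ¬ (∀ g ∈ 𝔓.decompositionSubgroup (Field.absoluteGaloisGroup ℚ), ∀ P : WeierstrassCurve.geomTorsion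 W ((3 : ℕ) : ℤ), g • P - P ∈ Φ)) → ∀ (Φ : AddSubgroup (WeierstrassCurve.geomTorsion W ((3 : ℕ) : ℤ))), Literature.NumberTheory.EllipticCurves.Rank1Residual.IsRationalLine W 3 Φ → ∀ (θsub θquot : FramedGaloisRep ℚ (padicCoeffIntegers (∅ : Set (PadicAlgCl 3))) 1), Literature.NumberTheory.EllipticCurves.KellerYin2024.IsTeichmullerLiftOn (∅ : Set (PadicAlgCl 3)) (Φ.map (WeierstrassCurve.geomTorsion W ((3 : ℕ) : ℤ)).subtype) θsub → Literature.NumberTheory.EllipticCurves.KellerYin2024.IsTeichmullerLiftOnQuot (∅ : Set (PadicAlgCl 3)) (Φ.map (WeierstrassCurve.geomTorsion W ((3 : ℕ) : ℤ)).subtype) (WeierstrassCurve.geomTorsion W ((3 : ℕ) : ℤ)) θquot → (∀ u : IsDedekindDomain.HeightOneSpectrum (NumberField.RingOfIntegers ℚ), ((3 : ℕ) : NumberField.RingOfIntegers ℚ) ∈ u.asIdeal → θsub.IsUnramifiedAt u) ∨ (∀ u : IsDedekindDomain.HeightOneSpectrum (NumberField.RingOfIntegers ℚ), ((3 : ℕ)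 : NumberField.RingOfIntegers ℚ) ∈ u.asIdeal → θquot.IsUnramifiedAt u))
    (halg : ∀ (W : WeierstrassCurve ℚ) [W.IsElliptic] [W.IsGloballyMinimal] (N : ℕ) [NeZero N] (K : Type) [Field K] [NumberField K], Summit.BirchSwinnertonDyer.Rank1Residual.Additive.ClassO6 W 3 → Literature.NumberTheory.EllipticCurves.Rank1Residual.Red W 3 → (∃ Φ : AddSubgroup (WeierstrassCurve.geomTorsion W ((3 : ℕ) : ℤ)), Literature.NumberTheory.EllipticCurves.Rank1Residual.IsRationalLine W 3 Φ ∧ ∀ (v : IsDedekindDomain.HeightOneSpectrum (NumberField.RingOfIntegers ℚ)), ((3 : ℕ) : NumberField.RingOfIntegers ℚ) ∈ v.asIdeal → ∀ 𝔓 ∈ v.primesAbove, ¬ (∀ g ∈ 𝔓.decompositionSubgroup (Field.absoluteGaloisGroup ℚ), ∀ P ∈ Φ, g • P = P) ∧ ¬ (∀ g ∈ 𝔓.decompositionSubgroup (Field.absoluteGaloisGroup ℚ), ∀ P : WeierstrassCurve.geomTorsion W ((3 : ℕ) : ℤ), g • P - P ∈ Φ)) → W.conductorNorm ℤ = N → Literature.NumberTheory.EllipticCurves.IsImaginaryQuadratic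 K → Literature.NumberTheory.EllipticCurves.SatisfiesHeegnerHypothesis N K → Odd (NumberField.discr K) → (∀ Q : (W.baseChange K).toAffine.Point, (3 : ℕ) • Q = 0 → Q = 0) → ∀ (κ : Literature.NumberTheory.EllipticCurves.ZpExtension K 3), κ.IsAnticyclotomic → ∀ (γ : Field.absoluteGaloisGroup K) [Fact (κ.IsTopGenerator γ)] (𝔭 : IsDedekindDomain.HeightOneSpectrum (NumberField.RingOfIntegers K)), ((3 : ℕ) : NumberField.RingOfIntegers K) ∈ 𝔭.asIdeal → 𝔭.asIdeal.ramificationIdx (NumberField.RingOfIntegers ℚ) = 1 → 𝔭.asIdeal.inertiaDeg (NumberField.RingOfIntegers ℚ) = 1 → ∀ (𝔭' : IsDedekindDomain.HeightOneSpectrum (NumberField.RingOfIntegers K)), ((3 : ℕ) : NumberField.RingOfIntegers K) ∈ 𝔭'.asIdeal → 𝔭' ≠ 𝔭 → ∀ (θsub θquot : FramedGaloisRep K (padicCoeffIntegers (∅ : Set (PadicAlgCl 3))) 1), Literature.NumberTheory.EllipticCurves.KellerYin2024.IsResidualPairOver (W.baseChange K) 3 θsub θquot → ∀ (Sf : Finset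 (IsDedekindDomain.HeightOneSpectrum (NumberField.RingOfIntegers K))), (∀ w : IsDedekindDomain.HeightOneSpectrum (NumberField.RingOfIntegers K), w ∈ Sf ↔ ((W.conductorNorm ℤ : ℤ) : NumberField.RingOfIntegers K) ∈ w.asIdeal) → ∀ (Dsub : Literature.NumberTheory.EllipticCurves.GreenbergVatsal2000.DatumDualData κ γ (Literature.NumberTheory.EllipticCurves.KellerYin2024.charModule (∅ : Set (PadicAlgCl 3)) θsub) (Literature.NumberTheory.EllipticCurves.Castella2018.AcSelmer.bdpData (Literature.NumberTheory.EllipticCurves.KellerYin2024.charModule (∅ : Set (PadicAlgCl 3)) θsub) 3 𝔭') ∅) (Dquot : Literature.NumberTheory.EllipticCurves.GreenbergVatsal2000.DatumDualData κ γ (Literature.NumberTheory.EllipticCurves.KellerYin2024.charModule (∅ : Set (PadicAlgCl 3)) θquot) (Literature.NumberTheory.EllipticCurves.Castella2018.AcSelmer.bdpData (Literature.NumberTheory.EllipticCurves.KellerYin2024.charModule (∅ : Set (PadicAlgCl 3)) θquot) 3 𝔭') ∅), Module.Finite (Literature.NumberTheory.EllipticCurves.IwasawaAlgebra 3) (Summit.BirchSwinnertonDyer.Rank1Residual.X11b.AcSelmer.XAc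 (W.baseChange K) 3 κ 𝔭' ∅ γ) ∧ Module.IsTorsion (Literature.NumberTheory.EllipticCurves.IwasawaAlgebra 3) (Summit.BirchSwinnertonDyer.Rank1Residual.X11b.AcSelmer.XAc (W.baseChange K) 3 κ 𝔭' ∅ γ) ∧ Literature.NumberTheory.EllipticCurves.muInvariant 3 (Summit.BirchSwinnertonDyer.Rank1Residual.X11b.AcSelmer.XAc (W.baseChange K) 3 κ 𝔭' ∅ γ) = 0 ∧ Literature.NumberTheory.EllipticCurves.lambdaInvariant 3 (Summit.BirchSwinnertonDyer.Rank1Residual.X11b.AcSelmer.XAc (W.baseChange K) 3 κ 𝔭' ∅ γ) + ∑ w ∈ Sf, Literature.NumberTheory.EllipticCurves.KellerYin2024.curveLocalLambda κ (W.baseChange K) w = Literature.NumberTheory.EllipticCurves.lambdaInvariant 3 Dsub.X + Literature.NumberTheory.EllipticCurves.lambdaInvariant 3 Dquot.X + ∑ w ∈ Sf, (Literature.NumberTheory.EllipticCurves.KellerYin2024.charLocalLambda (∅ : Set (PadicAlgCl 3)) κ θsub w + Literature.NumberTheory.EllipticCurves.KellerYin2024.charLocalLambda (∅ : Set (PadicAlgCl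 3)) κ θquot w))
    (han : ∀ (W : WeierstrassCurve ℚ) [W.IsElliptic] [W.IsGloballyMinimal] (N : ℕ) [NeZero N] (K : Type) [Field K] [NumberField K] (Dt : Literature.NumberTheory.EllipticCurves.ModularForms.ModularParametrizationData W N), Summit.BirchSwinnertonDyer.Rank1Residual.Additive.ClassO6 W 3 → Literature.NumberTheory.EllipticCurves.Rank1Residual.Red W 3 → (∃ Φ : AddSubgroup (WeierstrassCurve.geomTorsion W ((3 : ℕ) : ℤ)), Literature.NumberTheory.EllipticCurves.Rank1Residual.IsRationalLine W 3 Φ ∧ ∀ (v : IsDedekindDomain.HeightOneSpectrum (NumberField.RingOfIntegers ℚ)), ((3 : ℕ) : NumberField.RingOfIntegers ℚ) ∈ v.asIdeal → ∀ 𝔓 ∈ v.primesAbove, ¬ (∀ g ∈ 𝔓.decompositionSubgroup (Field.absoluteGaloisGroup ℚ), ∀ P ∈ Φ, g • P = P) ∧ ¬ (∀ g ∈ 𝔓.decompositionSubgroup (Field.absoluteGaloisGroup ℚ), ∀ P : WeierstrassCurve.geomTorsion W ((3 : ℕ) : ℤ), g • P - P ∈ Φ)) → W.analyticRank = 1 →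 W.conductorNorm ℤ = N → Literature.NumberTheory.EllipticCurves.IsImaginaryQuadratic K → Literature.NumberTheory.EllipticCurves.SatisfiesHeegnerHypothesis N K → Odd (NumberField.discr K) → ∀ (κ : Literature.NumberTheory.EllipticCurves.ZpExtension K 3), κ.IsAnticyclotomic → ∀ (γ : Field.absoluteGaloisGroup K) [Fact (κ.IsTopGenerator γ)] (𝔭 : IsDedekindDomain.HeightOneSpectrum (NumberField.RingOfIntegers K)), ((3 : ℕ) : NumberField.RingOfIntegers K) ∈ 𝔭.asIdeal → 𝔭.asIdeal.ramificationIdx (NumberField.RingOfIntegers ℚ) = 1 → 𝔭.asIdeal.inertiaDeg (NumberField.RingOfIntegers ℚ) = 1 → ∀ (𝔭' : IsDedekindDomain.HeightOneSpectrum (NumberField.RingOfIntegers K)), ((3 : ℕ) : NumberField.RingOfIntegers K) ∈ 𝔭'.asIdeal → 𝔭' ≠ 𝔭 → ∀ (ι' : PadicAlgCl 3 ≃+* ℂ), Summit.BirchSwinnertonDyer.BirchSwinnertonDyer.Theorems.SchneiderFree.BranchInducesPrime 3 ι' 𝔭 → ∀ (ΩK : ℂ) (Ωp : ℂ_[3])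 (L : Literature.NumberTheory.EllipticCurves.UnrSeries 3), ΩK ≠ 0 → Ωp ≠ 0 → Literature.NumberTheory.EllipticCurves.IsBDPLFunction ι' 𝔭 κ γ Dt.f ΩK Ωp L → ∀ (θsub θquot : FramedGaloisRep ℚ (padicCoeffIntegers (∅ : Set (PadicAlgCl 3))) 1), Literature.NumberTheory.EllipticCurves.KellerYin2024.IsResidualPairOver (W.baseChange K) 3 (θsub.restrictField K) (θquot.restrictField K) → ∀ (θunr : FramedGaloisRep ℚ (padicCoeffIntegers (∅ : Set (PadicAlgCl 3))) 1), (θunr = θsub ∨ θunr = θquot) → (∀ u : IsDedekindDomain.HeightOneSpectrum (NumberField.RingOfIntegers ℚ), ((3 : ℕ) : NumberField.RingOfIntegers ℚ) ∈ u.asIdeal → θunr.IsUnramifiedAt u) → ∀ (Sf : Finset (IsDedekindDomain.HeightOneSpectrum (NumberField.RingOfIntegers K))), (∀ w : IsDedekindDomain.HeightOneSpectrum (NumberField.RingOfIntegers K), w ∈ Sf ↔ ((W.conductorNorm ℤ : ℤ) : NumberField.RingOfIntegers K) ∈ w.asIdeal) → ∀ (θK : HeckeCharacter K), Literature.NumberTheory.EllipticCurves.KellerYin2024.IsHeckeCharOf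 ι' (θunr.restrictField K) θK → ∀ (Cbar : Finset (IsDedekindDomain.HeightOneSpectrum (NumberField.RingOfIntegers K))), (∀ u ∈ Cbar, ¬ θK.IsUnramifiedAt u) → ∀ (ΩK' : ℂ) (Ωp' : (Literature.NumberTheory.EllipticCurves.unrIntegers 3)ˣ) (Lφ : Literature.NumberTheory.EllipticCurves.UnrSeries 3), ΩK' ≠ 0 → Literature.NumberTheory.EllipticCurves.CastellaGrossiLeeSkinner2022.IsKatzLFunction ι' 𝔭 𝔭' Cbar κ γ θK ΩK' ((Ωp' : Literature.NumberTheory.EllipticCurves.unrIntegers 3) : ℂ_[3]) Lφ → ∃ n nφ : ℕ, Literature.NumberTheory.EllipticCurves.KellerYin2024.FirstUnitCoeffAt L n ∧ Literature.NumberTheory.EllipticCurves.KellerYin2024.FirstUnitCoeffAt Lφ nφ ∧ n + ∑ w ∈ Sf, Literature.NumberTheory.EllipticCurves.KellerYin2024.curveLocalLambda κ (W.baseChange K) w = 2 * nφ + ∑ w ∈ Sf, (Literature.NumberTheory.EllipticCurves.KellerYin2024.charLocalLambda (∅ : Set (PadicAlgCl 3)) κ (θsub.restrictField K) w + Literature.NumberTheory.EllipticCurves.KellerYin2024.charLocalLambda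 (∅ : Set (PadicAlgCl 3)) κ (θquot.restrictField K) w))
    (hram : ∀ (W : WeierstrassCurve ℚ) [W.IsElliptic] [W.IsGloballyMinimal] (N : ℕ) [NeZero N] (K : Type) [Field K] [NumberField K], Summit.BirchSwinnertonDyer.Rank1Residual.Additive.ClassO6 W 3 → Literature.NumberTheory.EllipticCurves.Rank1Residual.Red W 3 → (∃ Φ : AddSubgroup (WeierstrassCurve.geomTorsion W ((3 : ℕ) : ℤ)), Literature.NumberTheory.EllipticCurves.Rank1Residual.IsRationalLine W 3 Φ ∧ ∀ (v : IsDedekindDomain.HeightOneSpectrum (NumberField.RingOfIntegers ℚ)), ((3 : ℕ) : NumberField.RingOfIntegers ℚ) ∈ v.asIdeal → ∀ 𝔓 ∈ v.primesAbove, ¬ (∀ g ∈ 𝔓.decompositionSubgroup (Field.absoluteGaloisGroup ℚ), ∀ P ∈ Φ, g • P = P) ∧ ¬ (∀ g ∈ 𝔓.decompositionSubgroup (Field.absoluteGaloisGroup ℚ), ∀ P : WeierstrassCurve.geomTorsion W ((3 : ℕ) : ℤ), g • P - P ∈ Φ)) → W.conductorNorm ℤ = N → Literature.NumberTheory.EllipticCurves.IsImaginaryQuadratic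 K → Literature.NumberTheory.EllipticCurves.SatisfiesHeegnerHypothesis N K → Odd (NumberField.discr K) → (∀ Q : (W.baseChange K).toAffine.Point, (3 : ℕ) • Q = 0 → Q = 0) → ∀ (κ : Literature.NumberTheory.EllipticCurves.ZpExtension K 3), κ.IsAnticyclotomic → ∀ (γ : Field.absoluteGaloisGroup K) [Fact (κ.IsTopGenerator γ)] (𝔭 : IsDedekindDomain.HeightOneSpectrum (NumberField.RingOfIntegers K)), ((3 : ℕ) : NumberField.RingOfIntegers K) ∈ 𝔭.asIdeal → 𝔭.asIdeal.ramificationIdx (NumberField.RingOfIntegers ℚ) = 1 → 𝔭.asIdeal.inertiaDeg (NumberField.RingOfIntegers ℚ) = 1 → ∀ (𝔭' : IsDedekindDomain.HeightOneSpectrum (NumberField.RingOfIntegers K)), ((3 : ℕ) : NumberField.RingOfIntegers K) ∈ 𝔭'.asIdeal → 𝔭' ≠ 𝔭 → ∀ (ι' : PadicAlgCl 3 ≃+* ℂ), Summit.BirchSwinnertonDyer.BirchSwinnertonDyer.Theorems.SchneiderFree.BranchInducesPrime 3 ι' 𝔭 → ∀ (Φ : AddSubgroup (WeierstrassCurve.geomTorsion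 W ((3 : ℕ) : ℤ))), Literature.NumberTheory.EllipticCurves.Rank1Residual.IsRationalLine W 3 Φ → ∀ (θsub θquot : FramedGaloisRep ℚ (padicCoeffIntegers (∅ : Set (PadicAlgCl 3))) 1), Literature.NumberTheory.EllipticCurves.KellerYin2024.IsTeichmullerLiftOn (∅ : Set (PadicAlgCl 3)) (Φ.map (WeierstrassCurve.geomTorsion W ((3 : ℕ) : ℤ)).subtype) θsub → Literature.NumberTheory.EllipticCurves.KellerYin2024.IsTeichmullerLiftOnQuot (∅ : Set (PadicAlgCl 3)) (Φ.map (WeierstrassCurve.geomTorsion W ((3 : ℕ) : ℤ)).subtype) (WeierstrassCurve.geomTorsion W ((3 : ℕ) : ℤ)) θquot → ∀ (θunr θram : FramedGaloisRep ℚ (padicCoeffIntegers (∅ : Set (PadicAlgCl 3))) 1), ((θunr = θsub ∧ θram = θquot) ∨ (θunr = θquot ∧ θram = θsub)) → (∀ u : IsDedekindDomain.HeightOneSpectrum (NumberField.RingOfIntegers ℚ), ((3 : ℕ) : NumberField.RingOfIntegers ℚ) ∈ u.asIdeal → θunr.IsUnramifiedAt u) → ∀ (θK : HeckeCharacter K),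 Literature.NumberTheory.EllipticCurves.KellerYin2024.IsHeckeCharOf ι' (θunr.restrictField K) θK → ∀ (Cbar : Finset (IsDedekindDomain.HeightOneSpectrum (NumberField.RingOfIntegers K))), (∀ u ∈ Cbar, ¬ θK.IsUnramifiedAt u) → ∀ (ΩK' : ℂ) (Ωp' : (Literature.NumberTheory.EllipticCurves.unrIntegers 3)ˣ) (Lφ : Literature.NumberTheory.EllipticCurves.UnrSeries 3), ΩK' ≠ 0 → Literature.NumberTheory.EllipticCurves.CastellaGrossiLeeSkinner2022.IsKatzLFunction ι' 𝔭 𝔭' Cbar κ γ θK ΩK' ((Ωp' : Literature.NumberTheory.EllipticCurves.unrIntegers 3) : ℂ_[3]) Lφ → ∀ nφ : ℕ, Literature.NumberTheory.EllipticCurves.KellerYin2024.FirstUnitCoeffAt Lφ nφ → ∀ (Dram : Literature.NumberTheory.EllipticCurves.GreenbergVatsal2000.DatumDualData κ γ (Literature.NumberTheory.EllipticCurves.KellerYin2024.charModule (∅ : Set (PadicAlgCl 3)) (θram.restrictField K)) (Literature.NumberTheory.EllipticCurves.Castella2018.AcSelmer.bdpData (Literature.NumberTheory.EllipticCurves.KellerYin2024.charModule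 (∅ : Set (PadicAlgCl 3)) (θram.restrictField K)) 3 𝔭') ∅), Module.Finite (Literature.NumberTheory.EllipticCurves.IwasawaAlgebra 3) Dram.X ∧ Module.IsTorsion (Literature.NumberTheory.EllipticCurves.IwasawaAlgebra 3) Dram.X ∧ Literature.NumberTheory.EllipticCurves.muInvariant 3 Dram.X = 0 ∧ Literature.NumberTheory.EllipticCurves.lambdaInvariant 3 Dram.X = nφ)
    (hbr : CharMainConjOnTree 3) (hF1 : KatzLFunctionExistsFor 3) :
    ∀ (W : WeierstrassCurve ℚ) [W.IsElliptic] [W.IsGloballyMinimal] (N : ℕ) [NeZero N] (K : Type) [Field K] [NumberField K] (Dt : Literature.NumberTheory.EllipticCurves.ModularForms.ModularParametrizationData W N), Summit.BirchSwinnertonDyer.Rank1Residual.Additive.ClassO6 W 3 → Literature.NumberTheory.EllipticCurves.Rank1Residual.Red W 3 → (∃ Φ : AddSubgroup (WeierstrassCurve.geomTorsion W ((3 : ℕ) : ℤ)), Literature.NumberTheory.EllipticCurves.Rank1Residual.IsRationalLine W 3 Φ ∧ ∀ (v : IsDedekindDomain.HeightOneSpectrum (NumberField.RingOfIntegers ℚ)),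 ((3 : ℕ) : NumberField.RingOfIntegers ℚ) ∈ v.asIdeal → ∀ 𝔓 ∈ v.primesAbove, ¬ (∀ g ∈ 𝔓.decompositionSubgroup (Field.absoluteGaloisGroup ℚ), ∀ P ∈ Φ, g • P = P) ∧ ¬ (∀ g ∈ 𝔓.decompositionSubgroup (Field.absoluteGaloisGroup ℚ), ∀ P : WeierstrassCurve.geomTorsion W ((3 : ℕ) : ℤ), g • P - P ∈ Φ)) → W.analyticRank = 1 → W.conductorNorm ℤ = N → Literature.NumberTheory.EllipticCurves.IsImaginaryQuadratic K → Literature.NumberTheory.EllipticCurves.SatisfiesHeegnerHypothesis N K → Odd (NumberField.discr K) → ∀ (κ : Literature.NumberTheory.EllipticCurves.ZpExtension K 3), κ.IsAnticyclotomic → ∀ (γ : Field.absoluteGaloisGroup K) [Fact (κ.IsTopGenerator γ)] (𝔭 : IsDedekindDomain.HeightOneSpectrum (NumberField.RingOfIntegers K)), ((3 : ℕ) : NumberField.RingOfIntegers K) ∈ 𝔭.asIdeal → 𝔭.asIdeal.ramificationIdx (NumberField.RingOfIntegers ℚ) = 1 → 𝔭.asIdeal.inertiaDeg (NumberField.RingOfIntegers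 ℚ) = 1 → ∀ (𝔭' : IsDedekindDomain.HeightOneSpectrum (NumberField.RingOfIntegers K)), ((3 : ℕ) : NumberField.RingOfIntegers K) ∈ 𝔭'.asIdeal → 𝔭' ≠ 𝔭 → ∀ (ι' : PadicAlgCl 3 ≃+* ℂ), Summit.BirchSwinnertonDyer.BirchSwinnertonDyer.Theorems.SchneiderFree.BranchInducesPrime 3 ι' 𝔭 → ∀ (ΩK : ℂ) (Ωp : ℂ_[3]) (L : Literature.NumberTheory.EllipticCurves.UnrSeries 3), ΩK ≠ 0 → Ωp ≠ 0 → Literature.NumberTheory.EllipticCurves.IsBDPLFunction ι' 𝔭 κ γ Dt.f ΩK Ωp L → ∃ (g : Literature.NumberTheory.EllipticCurves.UnrSeries 3) (n : ℕ), (Summit.BirchSwinnertonDyer.Rank1Residual.X11b.AcSelmer.XAc.charIdeal (W.baseChange K) 3 κ 𝔭' ∅ γ).map (PowerSeries.map (Summit.BirchSwinnertonDyer.Rank1Residual.X11b.Halves.toUnr 3)) = Ideal.span {g} ∧ (∀ i < n, ‖((PowerSeries.coeff i g : Literature.NumberTheory.EllipticCurves.unrIntegers 3) : ℂ_[3])‖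 < 1) ∧ ‖((PowerSeries.coeff n g : Literature.NumberTheory.EllipticCurves.unrIntegers 3) : ℂ_[3])‖ = 1 ∧ (∀ i < n, ‖((PowerSeries.coeff i L : Literature.NumberTheory.EllipticCurves.unrIntegers 3) : ℂ_[3])‖ < 1) ∧ ‖((PowerSeries.coeff n L : Literature.NumberTheory.EllipticCurves.unrIntegers 3) : ℂ_[3])‖ = 1 := by
  intro W _ _ N _ K _ _ Dt hO6 hRed hcell hr hN hK hHN hodd κ hκ γ hγ 𝔭 h𝔭 he hf 𝔭' h𝔭' hne ι' hι ΩK Ωp L hΩK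
    hΩp hBDP
  -- §3: `FirstUnitCoeffAt L n` and `λ(𝔛) = n`
  obtain ⟨n, hLn, hlam⟩ := lambda_eq_of_characterCut hloc halg han hram hbr hF1 W N K Dt hO6 hRed hcell hr hN hK
    hHN hodd κ hκ γ 𝔭 h𝔭 he hf 𝔭' h𝔭' hne ι' hι ΩK Ωp L hΩK hΩp hBDP
  -- print ⟹ B1 ⟹ `Ch·R₀⟦T⟧ = (g)`, `g` of norm profile `λ(𝔛)`
  have hfin := CumulativeHeegnerInclusionAtThreeB1OfPrint.stub_residualSelmerFinite_of_print hP
    CumulativeHeegnerInclusionAtThreeLineDet.stub_lineDeterminantAtThree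
    CumulativeHeegnerInclusionAtThreeBadPlaces.stub_badPlacesSplitFinite W N K hO6 hRed hcell hN hK hHN κ hκ 𝔭' h𝔭'
  obtain ⟨-, g, hg, hglt, hgunit⟩ :=
    EisensteinCharacterInvariantsAtThreeAlgebraicHalf.isTorsion_and_normProfile_lambdaInvariant_of_residualFinite W K
      κ γ 𝔭' hfin
  rw [hlam] at hglt hgunit
  exact ⟨g, n, hg, hglt, hgunit, ((firstUnitCoeffAt_iff L n).mp hLn).2, ((firstUnitCoeffAt_iff L n).mp hLn).1⟩

end Summit.BirchSwinnertonDyer.BirchSwinnertonDyer.Theorems.EisensteinCharacterInvariantsAtThreeCharacterCutEq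

end
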